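import Literature.NumberTheory.GaloisRepresentations.LubinTateTowerCharacterCells
import HarnessLib

/-!
# The Lubin–Tate tower over a finite base extension `E ⊇ F` inside `F̄`:
# `Γ_E ⊵ Γ_E ∩ Gal(F̄/K_π^1) ⊵ Γ_E ∩ Gal(F̄/K_π^2) ⊵ ⋯`, cut out by the Lubin–Tate character
# restricted to `Γ_E` — the RELATIVE instantiation of the character cell maps
# (de Shalit 1987, I.1.8, I.3.3 (9): `G = Gal(k_ξ/k')` over the unramified base `k'`)

De Shalit 1987, I.1.8 / I.3.3 (p. 13, 18): over an unramified base `k' ⊇ k` the division tower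
`k'(W_f^{n+1})` has Galois group `G = Gal(k_ξ/k') ≅ ℤ_p^×` via `κ`, and the measures `μ_β` are pulled
back to `G` along `κ` ((9)–(10)). At `q = 2` the cell's Coleman theory runs over `𝒪_E` for ANY finite
`E ⊇ F` inside `F̄` with the ABSOLUTE Lubin–Tate group `f = πX + X²` of `F` (the family
`W_f^1 = {0, −π}` is `F`-rational: `LubinTateColemanRelativeTwo.lean`,
`LubinTateComparisonTraceTransportRelTwo.lean`), so the relevant tower over `E` is
`E·K_π^{n+1}` and its group is `Γ_E = Gal(F̄/E) ≤ Γ_F` with the RESTRICTED character `χ_π|_{Γ_E}`.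

`LubinTateTowerCharacterCells.lean` did the absolute case (`ltTower hπ : SubgroupTower Γ_F`,
`mem_ltTower_iff` = `hU`, `exists_toZModPow_ltCharacter_eq` = `hκ`). THIS FILE: for
`E : IntermediateField F (AlgebraicClosure F)`, finite over `F`,

* `ltRelTower hπ E : SubgroupTower Γ_E` (`Γ_E = ↥E.fixingSubgroup`), `U n := Γ_E ∩ ker (ltAbsChar hπ n)`
  (`= Gal(F̄/E·K_π^{n+1})`), `ltRelTower_U`, `ltRelTower_U_normal`, `mem_ltRelTower_U_iff`;
* the character `κ_E := κ ∘ (Γ_E ↪ Γ_F)`, `κ = (Units.map e) ∘ lubinTateCharHom hπ` (`e : 𝒪[F] ≃+* ℤ_[p]`);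
* **`mem_ltRelTower_iff`** = `hU` for `(ltRelTower, κ_E)` — from the absolute `hU`;
* **`fixingSubgroup_sup_ker_ltAbsChar_eq_top`**: if `E ∩ K_π^{n+1} = F` (lattice form
  `E ⊓ ltField π n = ⊥`) then `Γ_E · Gal(F̄/K_π^{n+1}) = Γ_F` (Krull's Galois correspondence for the
  open subgroup `Γ_E · ker`), whence **`exists_toZModPow_ltRelCharacter_eq`** = `hκ` for
  `(ltRelTower, κ_E)` under the DISJOINTNESS HYPOTHESIS `∀ n, E ⊓ ltField π n = ⊥` (true for `E/F`
  unramified, `K_π^{n+1}/F` being totally ramified — de Shalit I.1.8; supplied by the units lane's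
  relative tower theory, not proved here);
* `exists_ltRelCellMap` (the cell maps exist) and the composability certificate
  `integral_comap_restrictUnits_ltRelTower` (de Shalit's (10) on `Γ_E` at `p = 2`, via
  `GroupDistribution.integral_comap_restrictUnits_of_character_two`).

One definition with body (`ltRelTower`); theorems otherwise; no named facts, no instances, no
`sorry`. `PerfectField F` (e.g. characteristic `0`) is assumed where Krull's correspondence for
`F̄/F` is used.

## References

* [deShalit1987] E. de Shalit, *Iwasawa theory of elliptic curves with complex multiplication* (1987),
  I.1.8 (p. 13), I.3.3 (9), I.3.4 (10) (p. 17–18), III.1.3.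
* [CasselsFrohlichANT1967] J.-P. Serre, *Local class field theory*, Ch. VI of Cassels–Fröhlich (1967),
  §3.6 Prop. 6 (b).
* [NeukirchANT1999] J. Neukirch, *Algebraic Number Theory* (1999), Ch. IV §1 Thm. (1.2) (Krull).
-/

noncomputable section

open scoped Classical

namespace Literature.NumberTheory.GaloisRepresentations

section Relative

open ValuativeRel GaloisRepresentations.IsNonarchimedeanLocalField LubinTate
open Literature.NumberTheory.EllipticCurves

variable {F : Type*} [Field F] [ValuativeRel F] [TopologicalSpace F] [IsNonarchimedeanLocalField F]
variable {π : 𝒪[F]} (hπ : (valuation F).IsUniformizer (π : F))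
variable (E : IntermediateField F (AlgebraicClosure F))

/-! ### §1. The relative tower `Γ_E ∩ Gal(F̄/K_π^{n+1})` -/

/-- **The Lubin–Tate tower over `E`**: `U_n = Γ_E ∩ Gal(F̄/K_π^{n+1}) = Gal(F̄/E·K_π^{n+1})`, as a
tower of finite-index normal subgroups of `Γ_E = Gal(F̄/E)` (de Shalit's `G = Gal(k_ξ/k')` along the
division fields over the base `k' = E`). [cite: deShalit1987, I.1.8 (p. 13), I.3.3 (9) (p. 18)] -/
def ltRelTower : SubgroupTower ↥(E.fixingSubgroup.comap (Field.absoluteGaloisGroup.toAlgEquiv F).toMonoidHom) where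
  U n := ((ltAbsChar hπ n).ker).subgroupOf (E.fixingSubgroup.comap (Field.absoluteGaloisGroup.toAlgEquiv F).toMonoidHom)
  finiteIndex n := by
    haveI : ((ltAbsChar hπ n).ker).FiniteIndex := (ltTower hπ).finiteIndex n
    infer_instance
  succ_le n := fun σ hσ ↦
    Subgroup.mem_subgroupOf.mpr ((ltTower hπ).succ_le n (Subgroup.mem_subgroupOf.mp hσ))

/-- The levels of the relative tower. [cite: deShalit1987, I.3.3 (9) (p. 18)] -/
theorem ltRelTower_U (n : ℕ) :
    (ltRelTower hπ E).U n =
      ((ltAbsChar hπ n).ker).subgroupOf (E.fixingSubgroup.comap (Field.absoluteGaloisGroup.toAlgEquiv F).toMonoidHom) :=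
  rfl

/-- Membership in a level of the relative tower is membership of the underlying element of `Γ_F`
in the corresponding level of the absolute tower. [cite: deShalit1987, I.3.3 (9) (p. 18)] -/
theorem mem_ltRelTower_U_iff (n : ℕ)
    (σ : ↥(E.fixingSubgroup.comap (Field.absoluteGaloisGroup.toAlgEquiv F).toMonoidHom)) :
    σ ∈ (ltRelTower hπ E).U n ↔ (σ : Field.absoluteGaloisGroup F) ∈ (ltTower hπ).U n := by
  rw [ltRelTower_U, Subgroup.mem_subgroupOf, ltTower_U]

/-- The levels of the relative tower are normal in `Γ_E`.
[cite: CasselsFrohlichANT1967, Ch. VI §3.6 Prop. 6 (b)] -/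
theorem ltRelTower_U_normal (n : ℕ) : ((ltRelTower hπ E).U n).Normal := by
  rw [ltRelTower_U]
  infer_instance

/-! ### §2. `hU` for the relative tower -/

variable {p : ℕ} [Fact p.Prime] (e : 𝒪[F] ≃+* ℤ_[p])

/-- The value of the restricted character `κ_E = κ ∘ (Γ_E ↪ Γ_F)` in `ℤ_p`.
[cite: deShalit1987, I.3.3 (9) (p. 18)] -/
theorem coe_ltRelCharacter_apply (σ : ↥(E.fixingSubgroup.comap (Field.absoluteGaloisGroup.toAlgEquiv F).toMonoidHom)) :
    ((((Units.map (e : 𝒪[F] →+* ℤ_[p]).toMonoidHom).comp (lubinTateCharHom hπ)).comp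
        (E.fixingSubgroup.comap (Field.absoluteGaloisGroup.toAlgEquiv F).toMonoidHom).subtype σ : ℤ_[p]ˣ) : ℤ_[p]) =
      e (lubinTateChar hπ (σ : Field.absoluteGaloisGroup F) : 𝒪[F]) := rfl

/-- **`hU` for the relative Lubin–Tate tower**: `σ ∈ U_n ↔ σ ∈ U_0 ∧ κ_E(σ) ≡ 1 mod p^{n+1}` for
`σ ∈ Γ_E` — the hypothesis `hU` of `SubgroupTower.exists_cellMap_of_character` /
`cellMap_injective` for `(ltRelTower hπ E, κ_E)`, VERBATIM.
[cite: CasselsFrohlichANT1967, Ch. VI §3.6 Prop. 6 (b)] [cite: deShalit1987, I.3.3 (9) (p. 18)] -/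
theorem mem_ltRelTower_iff (n : ℕ) (σ : ↥(E.fixingSubgroup.comap (Field.absoluteGaloisGroup.toAlgEquiv F).toMonoidHom)) :
    σ ∈ (ltRelTower hπ E).U n ↔ σ ∈ (ltRelTower hπ E).U 0 ∧
      PadicInt.toZModPow (n + 1)
        ((((Units.map (e : 𝒪[F] →+* ℤ_[p]).toMonoidHom).comp (lubinTateCharHom hπ)).comp
          (E.fixingSubgroup.comap (Field.absoluteGaloisGroup.toAlgEquiv F).toMonoidHom).subtype σ : ℤ_[p]ˣ) : ℤ_[p]) =
        1 := by
  rw [mem_ltRelTower_U_iff, mem_ltRelTower_U_iff, MonoidHom.comp_apply, Subgroup.coe_subtype]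
  exact mem_ltTower_iff hπ e n σ

/-! ### §3. Disjointness `E ∩ K_π^{n+1} = F` gives `Γ_E · Gal(F̄/K_π^{n+1}) = Γ_F`, hence `hκ` -/

/-- `Gal(F̄/K_π^{n+1}) ≤ ker (ltAbsChar hπ n)` (read on `K`-algebra automorphisms of `F̄`): an
automorphism fixing `K_π^{n+1}` pointwise has trivial Lubin–Tate character of level `n + 1`.
[cite: CasselsFrohlichANT1967, Ch. VI §3.6 Prop. 6 (b)] -/
theorem fixingSubgroup_ltField_le_ker_ltAbsChar (n : ℕ) :
    (ltField π n).fixingSubgroup ≤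
      ((ltAbsChar hπ n).comp (Field.absoluteGaloisGroup.toAlgEquiv F).symm.toMonoidHom).ker := by
  haveI := isGalois_ltField hπ n
  intro σ hσ
  rw [IntermediateField.mem_fixingSubgroup_iff] at hσ
  rw [MonoidHom.mem_ker, MonoidHom.comp_apply, ltAbsChar_apply]
  have h1 : AlgEquiv.restrictNormalHom (ltField π n)
      (Field.absoluteGaloisGroup.toAlgEquiv F
        ((Field.absoluteGaloisGroup.toAlgEquiv F).symm.toMonoidHom σ)) = 1 := by
    ext x
    rw [MulEquiv.toMonoidHom_eq_coe, MonoidHom.coe_coe, MulEquiv.apply_symm_apply,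
      AlgEquiv.restrictNormalHom_apply, AlgEquiv.one_apply]
    exact hσ x x.2
  rw [h1, map_one]

/-- **Krull's correspondence step**: if `E ∩ K_π^{n+1} = F` (as subfields of `F̄`:
`E ⊓ ltField π n = ⊥`) then `Γ_E · ker = Gal(F̄/F)` for the kernel of the level-`(n+1)` character
(read on `F`-automorphisms of `F̄`) — the open subgroup `Γ_E · ker` has fixed field inside
`E ∩ K_π^{n+1} = F`. [cite: NeukirchANT1999, Ch. IV §1 Thm. (1.2)] [cite: deShalit1987, I.1.8 (p. 13)] -/
theorem fixingSubgroup_sup_ker_ltAbsChar_eq_top [PerfectField F] (n : ℕ)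
    (hdisj : E ⊓ ltField π n = ⊥) :
    E.fixingSubgroup ⊔
        ((ltAbsChar hπ n).comp (Field.absoluteGaloisGroup.toAlgEquiv F).symm.toMonoidHom).ker = ⊤ := by
  set N := ((ltAbsChar hπ n).comp (Field.absoluteGaloisGroup.toAlgEquiv F).symm.toMonoidHom).ker
    with hN
  set H := E.fixingSubgroup ⊔ N with hH
  have hopen : IsOpen (H : Set (AlgebraicClosure F ≃ₐ[F] AlgebraicClosure F)) :=
    Subgroup.isOpen_mono (le_sup_right.trans' (fixingSubgroup_ltField_le_ker_ltAbsChar hπ n))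
      (IntermediateField.fixingSubgroup_isOpen (ltField π n))
  -- the fixed field of `H` lies in `E` and in `K_π^{n+1}`, hence is `F`
  have hfix : IntermediateField.fixedField H = ⊥ := by
    refine le_bot_iff.mp (hdisj ▸ le_inf ?_ ?_)
    · calc IntermediateField.fixedField H
          ≤ IntermediateField.fixedField E.fixingSubgroup := IntermediateField.fixedField_le le_sup_left
        _ = E := InfiniteGalois.fixedField_fixingSubgroup E
    · calc IntermediateField.fixedField H
          ≤ IntermediateField.fixedField (ltField π n).fixingSubgroup :=
            IntermediateField.fixedField_le
              (le_sup_right.trans' (fixingSubgroup_ltField_le_ker_ltAbsChar hπ n))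
        _ = ltField π n := InfiniteGalois.fixedField_fixingSubgroup (ltField π n)
  -- `H` is open, hence closed, hence `H = Gal(F̄/F̄^H) = Gal(F̄/F) = ⊤`
  have hH' : (IntermediateField.fixedField H).fixingSubgroup = H :=
    InfiniteGalois.fixingSubgroup_fixedField ⟨H, H.isClosed_of_isOpen hopen⟩
  rw [← hH', hfix]
  exact IntermediateField.fixingSubgroup_bot

/-- **Representatives in `Γ_E`**: if `E ∩ K_π^{n+1} = F`, every `τ ∈ Γ_F` is `σ · k` with `σ ∈ Γ_E` and
`k` in the kernel of the level-`(n+1)` character (`Γ_E · Gal(F̄/K_π^{n+1}) = Γ_F`).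
[cite: NeukirchANT1999, Ch. IV §1 Thm. (1.2)] [cite: deShalit1987, I.1.8 (p. 13)] -/
theorem exists_mem_fixingSubgroup_mul_mem_ker [PerfectField F] (n : ℕ) (hdisj : E ⊓ ltField π n = ⊥)
    (τ : Field.absoluteGaloisGroup F) :
    ∃ σ ∈ E.fixingSubgroup.comap (Field.absoluteGaloisGroup.toAlgEquiv F).toMonoidHom,
      ∃ k ∈ (ltAbsChar hπ n).ker, τ = σ * k := by
  set N := ((ltAbsChar hπ n).comp (Field.absoluteGaloisGroup.toAlgEquiv F).symm.toMonoidHom).ker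
    with hN
  have hmem : Field.absoluteGaloisGroup.toAlgEquiv F τ ∈
      ((E.fixingSubgroup ⊔ N : Subgroup (AlgebraicClosure F ≃ₐ[F] AlgebraicClosure F)) :
        Set (AlgebraicClosure F ≃ₐ[F] AlgebraicClosure F)) := by
    rw [fixingSubgroup_sup_ker_ltAbsChar_eq_top hπ E n hdisj]
    exact Subgroup.mem_top _
  rw [Subgroup.mul_normal] at hmem
  obtain ⟨σ, hσ, k, hk, hστ⟩ := Set.mem_mul.mp hmem
  refine ⟨(Field.absoluteGaloisGroup.toAlgEquiv F).symm σ, ?_,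
    (Field.absoluteGaloisGroup.toAlgEquiv F).symm k, ?_, ?_⟩
  · rw [Subgroup.mem_comap, MulEquiv.toMonoidHom_eq_coe, MonoidHom.coe_coe, MulEquiv.apply_symm_apply]
    exact hσ
  · have hk' : k ∈ N := hk
    rw [hN, MonoidHom.mem_ker, MonoidHom.comp_apply] at hk'
    rw [MonoidHom.mem_ker]
    exact hk'
  · apply (Field.absoluteGaloisGroup.toAlgEquiv F).injective
    rw [map_mul, MulEquiv.apply_symm_apply, MulEquiv.apply_symm_apply, hστ]

/-- **`hκ` for the relative Lubin–Tate tower**: under the disjointness `E ∩ K_π^{n+1} = F` for all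
`n`, every `u ∈ ℤ_pˣ` with `u ≡ 1 mod p` is `≡ κ_E(σ) mod p^{n+1}` for some `σ ∈ Γ_E` in the level
`U_0` — the hypothesis `hκ` of `SubgroupTower.cellMap_fiberSurj` / `exists_cell_cellMap_eq` for
`(ltRelTower hπ E, κ_E)`, VERBATIM (absolute `hκ`, then move the witness into `Γ_E` along
`Γ_F = Γ_E · ker (ltAbsChar hπ n)`). [cite: deShalit1987, I.1.8 (p. 13), I.3.3 (9) (p. 18)]
[cite: CasselsFrohlichANT1967, Ch. VI §3.6 Prop. 6 (b)] -/
theorem exists_toZModPow_ltRelCharacter_eq [PerfectField F] (hdisj : ∀ n, E ⊓ ltField π n = ⊥)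
    (n : ℕ) (u : ℤ_[p]ˣ) (hu : PadicInt.toZModPow 1 (u : ℤ_[p]) = 1) :
    ∃ σ ∈ (ltRelTower hπ E).U 0,
      PadicInt.toZModPow (n + 1)
        ((((Units.map (e : 𝒪[F] →+* ℤ_[p]).toMonoidHom).comp (lubinTateCharHom hπ)).comp
          (E.fixingSubgroup.comap (Field.absoluteGaloisGroup.toAlgEquiv F).toMonoidHom).subtype σ :
            ℤ_[p]ˣ) : ℤ_[p]) =
        PadicInt.toZModPow (n + 1) (u : ℤ_[p]) := by
  obtain ⟨τ, -, hτ⟩ := exists_toZModPow_ltCharacter_eq hπ e n u hu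
  obtain ⟨σ, hσ, k, hk, rfl⟩ := exists_mem_fixingSubgroup_mul_mem_ker hπ E n (hdisj n) τ
  have hk' : PadicInt.toZModPow (n + 1)
      (((Units.map (e : 𝒪[F] →+* ℤ_[p]).toMonoidHom).comp (lubinTateCharHom hπ) k : ℤ_[p]ˣ) : ℤ_[p]) =
        1 := (mem_ltTower_U_iff_toZModPow hπ e n k).mp (by rw [ltTower_U]; exact hk)
  have hσn : PadicInt.toZModPow (n + 1)
      (((Units.map (e : 𝒪[F] →+* ℤ_[p]).toMonoidHom).comp (lubinTateCharHom hπ) σ : ℤ_[p]ˣ) : ℤ_[p]) =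
        PadicInt.toZModPow (n + 1) (u : ℤ_[p]) := by
    rw [← hτ, map_mul, Units.val_mul, map_mul, hk', mul_one]
  refine ⟨⟨σ, hσ⟩, ?_, hσn⟩
  -- `σ ∈ U_0` since `κ(σ) ≡ u ≡ 1 mod p`
  have hp : p.Prime := Fact.out
  haveI : NeZero (p ^ (n + 1)) := ⟨pow_ne_zero _ hp.ne_zero⟩
  rw [mem_ltRelTower_U_iff, mem_ltTower_U_iff_toZModPow hπ e 0]
  change PadicInt.toZModPow 1 _ = 1
  rw [← PadicInt.cast_toZModPow 1 (n + 1) (Nat.le_add_left 1 n), hσn,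
    PadicInt.cast_toZModPow 1 (n + 1) (Nat.le_add_left 1 n), hu]

/-- **The cell maps of the relative Lubin–Tate tower exist** (`SubgroupTower.exists_cellMap_of_character`
with `hU` = `mem_ltRelTower_iff`). [cite: deShalit1987, I.3.3 (9) (p. 18)] -/
theorem exists_ltRelCellMap :
    ∃ ψ : (n : ℕ) → ↥(E.fixingSubgroup.comap (Field.absoluteGaloisGroup.toAlgEquiv F).toMonoidHom) ⧸ (ltRelTower hπ E).U n →
        ZMod (p ^ (n + 1)),
      ∀ (n : ℕ) (σ : ↥(E.fixingSubgroup.comap (Field.absoluteGaloisGroup.toAlgEquiv F).toMonoidHom)),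
        σ ∈ (ltRelTower hπ E).U 0 →
          ψ n ((ltRelTower hπ E).proj n σ) = PadicInt.toZModPow (n + 1)
            ((((Units.map (e : 𝒪[F] →+* ℤ_[p]).toMonoidHom).comp (lubinTateCharHom hπ)).comp
              (E.fixingSubgroup.comap (Field.absoluteGaloisGroup.toAlgEquiv F).toMonoidHom).subtype σ : ℤ_[p]ˣ) :
                ℤ_[p]) :=
  (ltRelTower hπ E).exists_cellMap_of_character _ (mem_ltRelTower_iff hπ E e)

/-! ### §4. Composability certificate: de Shalit's (10) on `Γ_E` at `p = 2` -/

section Two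

variable (hπ₂ : (valuation F).IsUniformizer (π : F)) (e₂ : 𝒪[F] ≃+* ℤ_[2])

/-- **De Shalit's (10) on the relative Lubin–Tate tower of `F ≅ ℚ_2` over `E`** (`E ∩ K_π^{n+1} = F`
for all `n`, e.g. `E/F` unramified): for any bounded distribution `ν` on `ℤ_2`, any cell maps `ψ`
(`exists_ltRelCellMap`) and any uniformly continuous `g`, the pull-back of `ν|_{ℤ_2^×}` to `Γ_E`
integrates `σ ↦ 𝟙_{U_0}(σ) g(κ_E σ)` to `∫ g d(ν|_{ℤ_2^×})`
(`GroupDistribution.integral_comap_restrictUnits_of_character_two`; the normality instance is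
`fun n ↦ ltRelTower_U_normal hπ E n`, supply it with `haveI`). [cite: deShalit1987, I.3.4 (10) (p. 18)] -/
theorem integral_comap_restrictUnits_ltRelTower [PerfectField F] [∀ n, ((ltRelTower hπ₂ E).U n).Normal]
    (hdisj : ∀ n, E ⊓ ltField π n = ⊥)
    {𝕜 : Type*} [NormedField 𝕜] [IsUltrametricDist 𝕜] [CompleteSpace 𝕜]
    (ν : BoundedDistribution (ProfiniteTower.padicInt 2) 𝕜)
    (ψ : (n : ℕ) → ↥(E.fixingSubgroup.comap (Field.absoluteGaloisGroup.toAlgEquiv F).toMonoidHom) ⧸ (ltRelTower hπ₂ E).U n →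
      ZMod (2 ^ (n + 1)))
    (hψ : ∀ (n : ℕ) (σ : ↥(E.fixingSubgroup.comap (Field.absoluteGaloisGroup.toAlgEquiv F).toMonoidHom)),
      σ ∈ (ltRelTower hπ₂ E).U 0 →
        ψ n ((ltRelTower hπ₂ E).proj n σ) = PadicInt.toZModPow (n + 1)
          ((((Units.map (e₂ : 𝒪[F] →+* ℤ_[2]).toMonoidHom).comp (lubinTateCharHom hπ₂)).comp
            (E.fixingSubgroup.comap (Field.absoluteGaloisGroup.toAlgEquiv F).toMonoidHom).subtype σ : ℤ_[2]ˣ) : ℤ_[2]))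
    {g : ℤ_[2] → 𝕜} (hg : UniformContinuous g) :
    (GroupDistribution.comap (restrictUnits ν) ψ
        ((ltRelTower hπ₂ E).cellMap_trans _ ψ hψ)
        ((ltRelTower hπ₂ E).cellMap_injective _ (mem_ltRelTower_iff hπ₂ E e₂) ψ hψ)
        ((ltRelTower hπ₂ E).cellMap_fiberSurj _ (mem_ltRelTower_iff hπ₂ E e₂)
          (exists_toZModPow_ltRelCharacter_eq hπ₂ E e₂ hdisj) ψ hψ)).integral
        (fun σ ↦ (if (ltRelTower hπ₂ E).proj 0 σ = 1 then (1 : 𝕜) else 0) *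
          g (((((Units.map (e₂ : 𝒪[F] →+* ℤ_[2]).toMonoidHom).comp (lubinTateCharHom hπ₂)).comp
            (E.fixingSubgroup.comap (Field.absoluteGaloisGroup.toAlgEquiv F).toMonoidHom).subtype σ : ℤ_[2]ˣ) :
              ℤ_[2]))) =
      (restrictUnits ν).integral g :=
  GroupDistribution.integral_comap_restrictUnits_of_character_two _ ν (mem_ltRelTower_iff hπ₂ E e₂)
    (exists_toZModPow_ltRelCharacter_eq hπ₂ E e₂ hdisj) ψ hψ hg

end Two

end Relative

end Literature.NumberTheory.GaloisRepresentations

end
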